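import Summits.Ventures.QEC.Census.CertCover
import Summits.Ventures.QEC.Census.BZAutPermFast
import HarnessLib

/-!
# Transport THROUGH a two-sheeted cover: permutations compatible with the fibre map commute with `push` / `pull`
# (qec-type-12 g4 — the L-transport obligation of qec-search-9's `[[288,12,18]]` cover reduction, director R29;
#  type-10's review G3: «compatibility `P ∘ τ_g = τ_ḡ ∘ P` proved or decided»)

`Census/CertCover.lean` (qec-search-9) fixes a two-sheeted cover by index tables (`Cover2`: `f0`, `f1`, `qmap`) and the
word-level fibre sum `push` (`P`), pull-back `pull` (`P*`).  The cover certificate transports a downstairs word `u` to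
its orbit representative by a translation `ḡ` of the quotient group and needs the matching statement upstairs: the
upstairs translation `g` carries the solutions for `u` to the solutions for `ḡ·u`.  With the automorphisms as EXPLICIT
PERMUTATION TABLES (`Census/BZAutPerm.lean`: `permListOK`, `permFun`, `permEquiv`, `permWord`) this is one decidable
table identity plus two theorems:

* `Cover2.permCompatOK c perm permq` — both tables are permutations (of the `n` cover qubits / the `nq` base qubits) and
  `qmap (perm[q]) = permq[qmap q]` for every `q < n` (the fibre map is equivariant); `decide`;
* `Cover2.push_permWord` — then `push (perm · v) = permq · (push v)` for every word `v`
  (`perm · v := permWord (permFun perm) v n`, bit `q ↦ perm[q]`);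
* `Cover2.pull_permWord` — and `pull (permq · y) = perm · (pull y)`;
* word-level helpers `testBit_permWord_of_lt` / `testBit_permWord_of_le` (bits of a transported word through
  `permEquiv`), `popc_permWord_permFun` (transport preserves the weight).

Together with the landed transport facts upstairs (kernel / stabilizer row space / weight / labels are carried along a
row-map automorphism: `AutomorphismLabelAction`, `BZAutPerm.bzAut_perm_hφ`, `rowMapOK`) this gives: `v ↦ perm · v` is a
weight-preserving bijection from `{v : push v = u, H v = 0, v ∉ rs H'}` onto the same set for `permq · u` — so a
downstairs problem may be replaced by the problem of its orbit representative.  For the BB tower `288 → 144 → 72` the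
tables are the flat translations (`BB.translateIdx`) by `(a, b)` upstairs and `(a, b mod m')` downstairs; ANY compatible
pair is simply checked.  Tier KERNEL, axioms standard; no certificate is read here.
-/

namespace Summit.Ventures.QEC.Census

open Literature.InformationTheory.QuantumCodes

/-! ## Bits of a transported word -/

section Bits

variable {n : ℕ} {perm : List ℕ}

/-- Below `n`, bit `j` of `perm · v` is bit `σ⁻¹ j` of `v` (`σ = permEquiv n perm`). -/
theorem testBit_permWord_of_lt (h : permListOK n perm = true) (v : ℕ) (j : Fin n) :
    (permWord (permFun perm) v n).testBit j = v.testBit ((permEquiv n perm).symm j) := by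
  have e := congrFun (ofBits_permWord_permFun h v) j
  simp only [ofBits, Function.comp_apply] at e
  cases h1 : (permWord (permFun perm) v n).testBit j <;> cases h2 : v.testBit ((permEquiv n perm).symm j) <;>
    simp [h1, h2] at e ⊢

/-- From `n` on, `perm · v` has no bits (valid table). -/
theorem testBit_permWord_of_le (h : permListOK n perm = true) (v : ℕ) {j : ℕ} (hj : n ≤ j) :
    (permWord (permFun perm) v n).testBit j = false := by
  cases hb : (permWord (permFun perm) v n).testBit j
  · rfl
  · obtain ⟨q, -, hq⟩ := (testBit_permWord_permFun h v j).1 hb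
    have := (permEquiv n perm q).isLt
    omega

/-- Transport preserves the weight: `popc n (perm · v) = popc n v`. -/
theorem popc_permWord_permFun (h : permListOK n perm = true) (v : ℕ) :
    popc n (permWord (permFun perm) v n) = popc n v := by
  rw [← hammingNorm_ofBits, ← hammingNorm_ofBits, ofBits_permWord_permFun h, hammingNorm_comp_equiv]

end Bits

/-! ## Compatibility of a pair of permutation tables with the cover, and the two commutation theorems -/

namespace Cover2

variable {c : Cover2}

/-- **Compatibility check**: `perm` is a permutation of the `n` cover qubits, `permq` one of the `nq` base qubits, and
the fibre map intertwines them: `qmap (perm[q]) = permq[qmap q]` for all `q < n`. (definition, `decide`) -/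
def permCompatOK (c : Cover2) (perm permq : List ℕ) : Bool :=
  permListOK c.n perm && permListOK c.nq permq &&
    (List.range c.n).all fun q => c.Q (permFun perm q) == permFun permq (c.Q q)

section Compat

variable {perm permq : List ℕ}

/-- From the compatibility check: the upstairs table is a permutation. -/
private theorem hperm (hc : c.permCompatOK perm permq = true) : permListOK c.n perm = true := by
  simp only [permCompatOK, Bool.and_eq_true] at hc; exact hc.1.1

/-- From the compatibility check: the downstairs table is a permutation. -/
private theorem hpermq (hc : c.permCompatOK perm permq = true) : permListOK c.nq permq = true := by
  simp only [permCompatOK, Bool.and_eq_true] at hc; exact hc.1.2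

/-- The intertwining in `Equiv` form: `Q (σ q) = τ (Q q)`. -/
private theorem Q_sigma (h : c.ok = true) (hc : c.permCompatOK perm permq = true) (q : Fin c.n) :
    c.Q (permEquiv c.n perm q) = (permEquiv c.nq permq ⟨c.Q q, Q_lt h q.2⟩ : Fin c.nq) := by
  simp only [permCompatOK, Bool.and_eq_true, List.all_eq_true, List.mem_range, beq_iff_eq] at hc
  rw [permEquiv_val hc.1.1, permEquiv_val hc.1.2]
  exact hc.2 q q.2

/-- Hence `Q (σ⁻¹ q) = τ⁻¹ (Q q)`. -/
private theorem Q_sigma_symm (h : c.ok = true) (hc : c.permCompatOK perm permq = true) (q : Fin c.n) :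
    c.Q ((permEquiv c.n perm).symm q) = ((permEquiv c.nq permq).symm ⟨c.Q q, Q_lt h q.2⟩ : Fin c.nq) := by
  have e := Q_sigma h hc ((permEquiv c.n perm).symm q)
  rw [Equiv.apply_symm_apply] at e
  have e' : (⟨c.Q q, Q_lt h q.2⟩ : Fin c.nq) =
      permEquiv c.nq permq ⟨c.Q ((permEquiv c.n perm).symm q), Q_lt h ((permEquiv c.n perm).symm q).2⟩ :=
    Fin.ext e
  rw [e', Equiv.symm_apply_apply]

/-- **`push` commutes with compatible transports**: `push (perm · v) = permq · (push v)`. -/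
theorem push_permWord (h : c.ok = true) (hc : c.permCompatOK perm permq = true) (v : ℕ) :
    c.push (permWord (permFun perm) v c.n) = permWord (permFun permq) (c.push v) c.nq := by
  have hp := hperm hc
  have hq := hpermq hc
  apply Nat.eq_of_testBit_eq
  intro p
  by_cases hpn : p < c.nq
  · -- downstairs bit `p`; its preimage `p'' = τ⁻¹ p`
    set τ := permEquiv c.nq permq with hτ
    set σ := permEquiv c.n perm with hσ
    have hp'' := (τ.symm ⟨p, hpn⟩).2
    rw [push, testBit_mkBits_of_lt _ hpn, testBit_permWord_of_lt hq _ ⟨p, hpn⟩, push,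
      testBit_mkBits_of_lt _ hp'']
    have hF0 : c.F0 p < c.n := F0_lt h hpn
    have hF1 : c.F1 p < c.n := F1_lt h hpn
    rw [show c.F0 p = ((⟨c.F0 p, hF0⟩ : Fin c.n) : ℕ) from rfl, testBit_permWord_of_lt hp v ⟨c.F0 p, hF0⟩,
      show c.F1 p = ((⟨c.F1 p, hF1⟩ : Fin c.n) : ℕ) from rfl, testBit_permWord_of_lt hp v ⟨c.F1 p, hF1⟩]
    -- the two preimages `a = σ⁻¹ (F0 p)`, `b = σ⁻¹ (F1 p)` form the fibre of `p''`
    set a := σ.symm ⟨c.F0 p, hF0⟩ with ha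
    set b := σ.symm ⟨c.F1 p, hF1⟩ with hb
    set p'' : ℕ := ((τ.symm ⟨p, hpn⟩ : Fin c.nq) : ℕ) with hp''def
    have hQa : c.Q a = p'' := by
      have e := Q_sigma_symm h hc ⟨c.F0 p, hF0⟩
      rw [← ha] at e
      rw [e, hp''def]
      congr 2
      exact Fin.ext (Q_F0 h hpn)
    have hQb : c.Q b = p'' := by
      have e := Q_sigma_symm h hc ⟨c.F1 p, hF1⟩
      rw [← hb] at e
      rw [e, hp''def]
      congr 2
      exact Fin.ext (Q_F1 h hpn)
    have hab : (a : ℕ) ≠ b := by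
      intro e
      have e' : a = b := Fin.ext e
      rw [ha, hb, Equiv.apply_eq_iff_eq] at e'
      exact F0_ne_F1 h hpn (congrArg Fin.val e')
    have ha' := F0_Q_or_F1_Q h a.2
    have hb' := F0_Q_or_F1_Q h b.2
    rw [hQa] at ha'
    rw [hQb] at hb'
    rcases ha' with ha0 | ha1 <;> rcases hb' with hb0 | hb1
    · exact absurd (ha0.symm.trans hb0) hab
    · rw [← ha0, ← hb1]
    · rw [← ha1, ← hb0, Bool.xor_comm]
    · exact absurd (ha1.symm.trans hb1) hab
  · rw [push, testBit_mkBits_of_le _ (not_lt.1 hpn), testBit_permWord_of_le hq _ (not_lt.1 hpn)]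

/-- **`pull` commutes with compatible transports**: `pull (permq · y) = perm · (pull y)`. -/
theorem pull_permWord (h : c.ok = true) (hc : c.permCompatOK perm permq = true) (y : ℕ) :
    c.pull (permWord (permFun permq) y c.nq) = permWord (permFun perm) (c.pull y) c.n := by
  have hp := hperm hc
  have hq := hpermq hc
  apply Nat.eq_of_testBit_eq
  intro q
  by_cases hqn : q < c.n
  · have hQ : c.Q q < c.nq := Q_lt h hqn
    have e1 : (c.pull (permWord (permFun permq) y c.nq)).testBit q =
        (permWord (permFun permq) y c.nq).testBit (c.Q q) := by
      rw [pull, testBit_mkBits_of_lt _ hqn]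
    have e2 : (permWord (permFun permq) y c.nq).testBit (c.Q q) =
        y.testBit ((permEquiv c.nq permq).symm ⟨c.Q q, hQ⟩) := testBit_permWord_of_lt hq y ⟨c.Q q, hQ⟩
    have e3 : (permWord (permFun perm) (c.pull y) c.n).testBit q =
        (c.pull y).testBit ((permEquiv c.n perm).symm ⟨q, hqn⟩) := testBit_permWord_of_lt hp _ ⟨q, hqn⟩
    have e4 : (c.pull y).testBit ((permEquiv c.n perm).symm ⟨q, hqn⟩) =
        y.testBit (c.Q ((permEquiv c.n perm).symm ⟨q, hqn⟩)) := by
      rw [pull, testBit_mkBits_of_lt _ ((permEquiv c.n perm).symm ⟨q, hqn⟩).2]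
    rw [e1, e2, e3, e4, Q_sigma_symm h hc ⟨q, hqn⟩]
  · rw [pull, testBit_mkBits_of_le _ (not_lt.1 hqn), testBit_permWord_of_le hp _ (not_lt.1 hqn)]

end Compat

/-! ## Control (kernel `decide`) -/

/-- On the toy cover of `CertCover.lean` (`n = 4`, `nq = 2`, fibres `{0,2}`, `{1,3}`): swapping the two fibres
upstairs (`[1,0,3,2]`) is compatible with the swap `[1,0]` downstairs, and `push`/`pull` commute with it; the sheet swap
`[2,3,0,1]` is compatible with the identity downstairs; a swap inside ONE fibre position only (`[1,0,2,3]`) is not. -/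
example : toyCover2.permCompatOK [1, 0, 3, 2] [1, 0] = true ∧ toyCover2.permCompatOK [2, 3, 0, 1] [0, 1] = true ∧
    toyCover2.permCompatOK [1, 0, 2, 3] [1, 0] = false ∧
    toyCover2.push (permWord (permFun [1, 0, 3, 2]) 7 4) = permWord (permFun [1, 0]) (toyCover2.push 7) 2 ∧
    toyCover2.pull (permWord (permFun [1, 0]) 1 2) = permWord (permFun [1, 0, 3, 2]) (toyCover2.pull 1) 4 := by
  decide

end Cover2

end Summit.Ventures.QEC.Census
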